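import Literature.NumberTheory.EllipticCurves.FramedTateGaloisRep
import Literature.NumberTheory.GaloisRepresentations.GoodDihedralLocalImage
import Literature.AlgebraicGeometry.Motives.FaltingsECEndOfCoreProofs
import HarnessLib

/-!
# Absolute irreducibility of `V_ℓ E` for a non-CM curve from one split semisimple element
(route `SkinnerWilesDefectOne`, item stmt-Langlands-12922 `FiveIsogenyEllipticCurves`, helper)

The target `ReducibleOrdinaryModular` wants `ρ.toGaloisRep.IsIrreducible` for the FRAMED
representation `ρ : Γ_K →ₜ* GL₂(ℚ̄_ℓ)`, i.e. irreducibility of `V_ℓ E ⊗ ℚ̄_ℓ` (absolute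
irreducibility).  The tree proves Serre's theorem (1968, IV.2.1, from Shafarevich's theorem) in
the rational form: for `E` over a number field without `K`-rational complex multiplication,
`V_ℓ E` has no `Γ_K`-stable `ℚ_ℓ`-LINE
(`Literature.AlgebraicGeometry.Motives.finrank_ne_one_of_stable_of_not_hasRationalCM_of_numberField`).
This file bridges the two when some `τ₀ ∈ Γ_K` acts on `V_ℓ E` as a split semisimple element
with the two distinct `ℚ_ℓ`-RATIONAL eigenvalues `1 ≠ u` — as an inertia element at a place of
good ordinary reduction above `ℓ` does: then every `ρ(τ₀)`-stable `ℚ̄_ℓ`-line is spanned by a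
rational eigenvector (`exists_smul_eq_of_apply_eq_smul`), so a common eigenvector of `ρ(Γ_K)` in
`ℚ̄_ℓ²` would produce a stable `ℚ_ℓ`-line (`not_hasCommonEigenvector_framedTate`), and the framed
representation is irreducible (`isIrreducible_toGaloisRep_framedTate`,
`isIrreducible_iff_not_hasCommonEigenvector`).

References: J.-P. Serre, *Abelian ℓ-adic representations and elliptic curves* (1968), IV.2.1
and IV A.2.2; G. Faltings, Invent. Math. 73 (1983), §5.
-/

noncomputable section

-- `Summit.Langlands.Langlands.…`: summit = sub-problem name (D-0017 layout), as in every Theorems file here.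
set_option linter.dupNamespace false

open scoped MatrixGroups Matrix
open Field Module
open Literature.NumberTheory.EllipticCurves Literature.NumberTheory.GaloisRepresentations
open Literature.AlgebraicGeometry.Motives

namespace Summit.Langlands.Langlands.Theorems.FiveIsogenyEllipticCurves

universe u

/-! ### Linear algebra: an eigenline of a split semisimple endomorphism in dimension two -/

section LinearAlgebra

variable {F : Type*} [Field F] {V : Type*} [AddCommGroup V] [Module F V] [FiniteDimensional F V]

/-- **In dimension two, a proper eigenspace is a line**: if `T v = a v` with `v ≠ 0` and some
`x` has `T x ≠ a x`, then every `w` with `T w = a w` is a multiple of `v` (the eigenspace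
`ker (T - a)` is a proper non-zero subspace of a plane). [folklore] -/
theorem exists_smul_eq_of_apply_eq_smul (hV : finrank F V = 2) (T : V →ₗ[F] V) {a : F} {v x : V}
    (hv : v ≠ 0) (hTv : T v = a • v) (hx : T x ≠ a • x) {w : V} (hw : T w = a • w) :
    ∃ μ : F, w = μ • v := by
  set E : Submodule F V := LinearMap.ker (T - a • LinearMap.id) with hE
  have hmem : ∀ y : V, y ∈ E ↔ T y = a • y := fun y => by
    rw [hE, LinearMap.mem_ker, LinearMap.sub_apply, LinearMap.smul_apply, LinearMap.id_apply,
      sub_eq_zero]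
  have hvE : v ∈ E := (hmem v).mpr hTv
  have hwE : w ∈ E := (hmem w).mpr hw
  have hne : E ≠ ⊤ := fun htop => hx ((hmem x).mp (htop ▸ Submodule.mem_top))
  have hlt : finrank F E < 2 := hV ▸ Submodule.finrank_lt hne
  have hpos : 0 < finrank F E := by
    rw [finrank_pos_iff_exists_ne_zero]
    exact ⟨⟨v, hvE⟩, fun h => hv (congrArg Subtype.val h)⟩
  have h1 : finrank F E = 1 := by omega
  have hv' : (⟨v, hvE⟩ : E) ≠ 0 := fun h => hv (congrArg Subtype.val h)
  obtain ⟨μ, hμ⟩ := (finrank_eq_one_iff_of_nonzero' (⟨v, hvE⟩ : E) hv').mp h1 ⟨w, hwE⟩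
  exact ⟨μ, (congrArg Subtype.val hμ).symm⟩

end LinearAlgebra

/-! ### Matrices: rational eigenlines of a split rational matrix, over an extension -/

section Matrices

variable {k : Type*} [Field k] {F : Type*} [Field F] (f : k →+* F)

/-- Mapping a matrix–vector product along a ring homomorphism. [folklore] -/
theorem map_mulVec_comp (M : Matrix (Fin 2) (Fin 2) k) (c : Fin 2 → k) :
    (M.map f) *ᵥ (f ∘ c) = f ∘ (M *ᵥ c) := by
  funext i
  exact (RingHom.map_mulVec f M c i).symm

/-- `(u • 1).map f = f u • 1` for square matrices. [folklore] -/
theorem map_smul_one (u : k) :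
    ((u • (1 : Matrix (Fin 2) (Fin 2) k)).map f) = f u • (1 : Matrix (Fin 2) (Fin 2) F) := by
  ext i j
  by_cases hij : i = j
  · subst hij; simp
  · simp [Matrix.one_apply_ne hij]

/-- **Over an extension, an eigenvector of a split semisimple rational matrix is a multiple of a
rational eigenvector.**  Let `M ∈ M₂(k)` have rational eigenvectors `c₁` (eigenvalue `1`) and `cᵤ`
(eigenvalue `u ≠ 1`) and satisfy `(M - 1)(M - u) = 0`.  If `w ∈ F²` (`F ⊇ k`) is an eigenvector of
`M`, then `w` is an `F`-multiple of `f ∘ c₁` or of `f ∘ cᵤ`. [folklore] -/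
theorem exists_smul_rational_of_eigenvector {M : Matrix (Fin 2) (Fin 2) k} {u : k} (hu : u ≠ 1)
    (hM : (M - 1) * (M - u • 1) = 0)
    {c₁ cᵤ : Fin 2 → k} (hc₁ : c₁ ≠ 0) (hcᵤ : cᵤ ≠ 0) (h₁ : M *ᵥ c₁ = c₁) (hᵤ : M *ᵥ cᵤ = u • cᵤ)
    {w : Fin 2 → F} (hw0 : w ≠ 0) {a : F} (hw : (M.map f) *ᵥ w = a • w) :
    ∃ μ : F, w = μ • (f ∘ c₁) ∨ w = μ • (f ∘ cᵤ) := by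
  set T : (Fin 2 → F) →ₗ[F] (Fin 2 → F) := Matrix.toLin' (M.map f) with hT
  have hTapply : ∀ y, T y = (M.map f) *ᵥ y := fun y => Matrix.toLin'_apply _ _
  have hfc₁ : f ∘ c₁ ≠ 0 := fun h => hc₁ (funext fun i => f.injective (by
    simpa using congrFun h i))
  have hfcᵤ : f ∘ cᵤ ≠ 0 := fun h => hcᵤ (funext fun i => f.injective (by
    simpa using congrFun h i))
  have hT₁ : T (f ∘ c₁) = (1 : F) • (f ∘ c₁) := by
    rw [hTapply, map_mulVec_comp, h₁, one_smul]
  have hTᵤ : T (f ∘ cᵤ) = f u • (f ∘ cᵤ) := by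
    rw [hTapply, map_mulVec_comp, hᵤ]
    funext i
    simp
  have hfu : f u ≠ 1 := fun h => hu (f.injective (by rw [h, map_one]))
  have hTw : T w = a • w := by rw [hTapply, hw]
  -- `(M.map f - 1)(M.map f - f u) = 0`
  have hMF : (M.map f - 1) * (M.map f - f u • 1) = 0 := by
    have e : (M.map f - 1) * (M.map f - f u • 1) = ((M - 1) * (M - u • 1)).map f := by
      rw [Matrix.map_mul, Matrix.map_sub f (map_sub f), Matrix.map_sub f (map_sub f),
        Matrix.map_one f (map_zero f) (map_one f), map_smul_one]
    rw [e, hM, Matrix.map_zero f (map_zero f)]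
  -- the eigenvalue `a` is `1` or `f u`
  have ha : a = 1 ∨ a = f u := by
    have hinner : (M.map f - f u • 1) *ᵥ w = (a - f u) • w := by
      rw [Matrix.sub_mulVec, Matrix.smul_mulVec, Matrix.one_mulVec, hw, sub_smul]
    have h2 : ((M.map f - 1) * (M.map f - f u • 1)) *ᵥ w = ((a - 1) * (a - f u)) • w := by
      rw [← Matrix.mulVec_mulVec, hinner, Matrix.mulVec_smul, Matrix.sub_mulVec, Matrix.one_mulVec,
        hw]
      have e : a • w - w = (a - 1) • w := by rw [sub_smul, one_smul]
      rw [e, smul_smul, mul_comm]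
    rw [hMF, Matrix.zero_mulVec] at h2
    rcases smul_eq_zero.mp h2.symm with h | h
    · rcases mul_eq_zero.mp h with h' | h'
      · exact Or.inl (sub_eq_zero.mp h')
      · exact Or.inr (sub_eq_zero.mp h')
    · exact absurd h hw0
  have hV : finrank F (Fin 2 → F) = 2 := by simp
  rcases ha with rfl | rfl
  · -- eigenvalue `1`: `w ∥ f ∘ c₁`
    have hx : T (f ∘ cᵤ) ≠ (1 : F) • (f ∘ cᵤ) := by
      rw [hTᵤ]
      intro h
      exact hfu (smul_left_injective F hfcᵤ h)
    obtain ⟨μ, hμ⟩ := exists_smul_eq_of_apply_eq_smul hV T hfc₁ hT₁ hx hTw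
    exact ⟨μ, Or.inl hμ⟩
  · -- eigenvalue `f u`: `w ∥ f ∘ cᵤ`
    have hx : T (f ∘ c₁) ≠ f u • (f ∘ c₁) := by
      rw [hT₁]
      intro h
      exact hfu (smul_left_injective F hfc₁ h).symm
    obtain ⟨μ, hμ⟩ := exists_smul_eq_of_apply_eq_smul hV T hfcᵤ hTᵤ hx hTw
    exact ⟨μ, Or.inr hμ⟩

/-- **Eigenvalues of a rational vector are rational.**  If `(M.map f) (f ∘ c) = a • (f ∘ c)` with
`c ≠ 0` rational, then `a = f q` and `M *ᵥ c = q • c` for some `q ∈ k`. [folklore] -/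
theorem exists_eq_map_of_mulVec_comp_eq_smul {M : Matrix (Fin 2) (Fin 2) k} {c : Fin 2 → k}
    (hc : c ≠ 0) {a : F} (h : (M.map f) *ᵥ (f ∘ c) = a • (f ∘ c)) :
    ∃ q : k, a = f q ∧ M *ᵥ c = q • c := by
  obtain ⟨i, hi⟩ : ∃ i, c i ≠ 0 := by
    by_contra hall
    push Not at hall
    exact hc (funext hall)
  rw [map_mulVec_comp] at h
  refine ⟨(M *ᵥ c) i / c i, ?_, ?_⟩
  · have hi' := congrFun h i
    simp only [Function.comp_apply, Pi.smul_apply, smul_eq_mul] at hi'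
    rw [map_div₀, eq_div_iff ((map_ne_zero f).mpr hi), hi']
  · funext j
    have hj := congrFun h j
    have hi' := congrFun h i
    simp only [Function.comp_apply, Pi.smul_apply, smul_eq_mul] at hj hi'
    apply f.injective
    rw [Pi.smul_apply, smul_eq_mul, map_mul, map_div₀, hj, hi', mul_div_assoc,
      div_self ((map_ne_zero f).mpr hi), mul_one]

end Matrices

/-! ### Elliptic curves: absolute irreducibility of the framed Tate module -/

section Elliptic

variable {K : Type u} [Field K] [NumberField K] (W : WeierstrassCurve K) [W.IsElliptic] (ℓ : ℕ)
  [Fact ℓ.Prime]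

/-- A stable vector gives a stable line of dimension one — excluded by Serre IV.2.1 for a curve
without complex multiplication. [cite: Serre1968, Ch. IV §2.1] -/
theorem false_of_forall_apply_eq_smul (hCM : ¬ W.HasCM) {v : W.rationalTateModule ℓ} (hv : v ≠ 0)
    (h : ∀ σ : absoluteGaloisGroup K, ∃ q : ℚ_[ℓ], W.rationalGaloisRepTate ℓ σ v = q • v) : False := by
  have hCM' : ¬ W.HasRationalCM := fun h' => hCM h'.hasCM
  refine finrank_ne_one_of_stable_of_not_hasRationalCM_of_numberField W ℓ hCM' (ℚ_[ℓ] ∙ v)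
    (fun σ y hy => ?_) (finrank_span_singleton hv)
  obtain ⟨c, rfl⟩ := Submodule.mem_span_singleton.mp hy
  obtain ⟨q, hq⟩ := h σ
  rw [map_smul, hq, smul_smul]
  exact Submodule.smul_mem _ _ (Submodule.mem_span_singleton_self v)

/-- **No common eigenvector for `V_ℓ E ⊗ ℚ̄_ℓ`** (non-CM `E` over a number field, given a split
semisimple `τ₀`).  Let `b` be a `ℚ_ℓ`-basis of `V_ℓ E` and suppose `τ₀ ∈ Γ_K` acts on `V_ℓ E`
with `(ρ(τ₀) - 1)(ρ(τ₀) - u) = 0`, `u ≠ 1`, and eigenvectors `v₁` (eigenvalue `1`) and `vᵤ`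
(eigenvalue `u`).  Then the matrices of `Γ_K` in `b`, pushed to `GL₂(ℚ̄_ℓ)`
(`framedTateGaloisRepOfBasis`), have no common eigenvector in `ℚ̄_ℓ²`: such a vector would be a
multiple of the image of `b.repr v₁` or `b.repr vᵤ` (`exists_smul_rational_of_eigenvector`), whose
eigenvalues are then rational (`exists_eq_map_of_mulVec_comp_eq_smul`), making `ℚ_ℓ v₁` or
`ℚ_ℓ vᵤ` a stable line (`false_of_forall_apply_eq_smul`). [cite: Serre1968, Ch. IV §2.1] -/
theorem not_hasCommonEigenvector_framedTate (hCM : ¬ W.HasCM)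
    (b : Module.Basis (Fin 2) ℚ_[ℓ] (W.rationalTateModule ℓ)) {τ₀ : absoluteGaloisGroup K}
    {u : ℚ_[ℓ]} (hu : u ≠ 1)
    (hC : (W.rationalGaloisRepTate ℓ τ₀ - 1) * (W.rationalGaloisRepTate ℓ τ₀ - u • 1) = 0)
    {v₁ vᵤ : W.rationalTateModule ℓ} (hv₁ : v₁ ≠ 0) (hvᵤ : vᵤ ≠ 0)
    (h₁ : W.rationalGaloisRepTate ℓ τ₀ v₁ = v₁) (hᵤ : W.rationalGaloisRepTate ℓ τ₀ vᵤ = u • vᵤ) :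
    ¬ HasCommonEigenvector
      (W.framedTateGaloisRepOfBasis ℓ (W.continuous_rationalGaloisRepTate_holds ℓ) b :
        absoluteGaloisGroup K →* GL (Fin 2) (PadicAlgCl ℓ)) := by
  classical
  rintro ⟨w, hw0, hw⟩
  set f : ℚ_[ℓ] →+* PadicAlgCl ℓ := algebraMap ℚ_[ℓ] (PadicAlgCl ℓ) with hf
  set ρ := W.rationalGaloisRepTate ℓ with hρ
  set M : absoluteGaloisGroup K → Matrix (Fin 2) (Fin 2) ℚ_[ℓ] :=
    fun σ => LinearMap.toMatrix b b (ρ σ) with hM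
  have hmat : ∀ σ, ((W.framedTateGaloisRepOfBasis ℓ (W.continuous_rationalGaloisRepTate_holds ℓ) b σ :
      GL (Fin 2) (PadicAlgCl ℓ)) : Matrix (Fin 2) (Fin 2) (PadicAlgCl ℓ)) = (M σ).map f := fun σ =>
    W.coe_framedTateGaloisRepOfBasis_apply ℓ _ b σ
  have hw' : ∀ σ, ∃ a : PadicAlgCl ℓ, (M σ).map f *ᵥ w = a • w := fun σ => by
    obtain ⟨a, ha⟩ := hw σ
    exact ⟨a, by rw [← hmat]; exact ha⟩
  -- rational eigenvectors of `M τ₀`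
  set c₁ : Fin 2 → ℚ_[ℓ] := ⇑(b.repr v₁) with hc₁def
  set cᵤ : Fin 2 → ℚ_[ℓ] := ⇑(b.repr vᵤ) with hcᵤdef
  have hrepr : ∀ (σ : absoluteGaloisGroup K) (v : W.rationalTateModule ℓ),
      M σ *ᵥ ⇑(b.repr v) = ⇑(b.repr (ρ σ v)) := fun σ v => LinearMap.toMatrix_mulVec_repr b b _ v
  have hne : ∀ {v : W.rationalTateModule ℓ}, v ≠ 0 → (⇑(b.repr v) : Fin 2 → ℚ_[ℓ]) ≠ 0 := by
    intro v hv h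
    exact hv (b.repr.injective (DFunLike.coe_injective (by rw [h, map_zero, Finsupp.coe_zero])))
  have hc₁ : c₁ ≠ 0 := hne hv₁
  have hcᵤ : cᵤ ≠ 0 := hne hvᵤ
  have hM₁ : M τ₀ *ᵥ c₁ = c₁ := by rw [hc₁def, hrepr, h₁]
  have hMᵤ : M τ₀ *ᵥ cᵤ = u • cᵤ := by rw [hcᵤdef, hrepr, hᵤ, map_smul, Finsupp.coe_smul]
  have hMC : (M τ₀ - 1) * (M τ₀ - u • 1) = 0 := by
    have e : (M τ₀ - 1) * (M τ₀ - u • 1) = LinearMap.toMatrix b b ((ρ τ₀ - 1) * (ρ τ₀ - u • 1)) := by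
      rw [Module.End.mul_eq_comp, LinearMap.toMatrix_comp b b b, map_sub, map_sub,
        LinearMap.toMatrix_one, map_smul, LinearMap.toMatrix_one]
    rw [e, hC, map_zero]
  -- the common eigenvector is a multiple of a rational eigenvector
  obtain ⟨a₀, ha₀⟩ := hw' τ₀
  obtain ⟨μ, hμ⟩ := exists_smul_rational_of_eigenvector f hu hMC hc₁ hcᵤ hM₁ hMᵤ hw0 ha₀
  have hμ0 : μ ≠ 0 := by
    rintro rfl
    rcases hμ with h | h <;> exact hw0 (by rw [h, zero_smul])
  -- the corresponding rational vector is a common eigenvector with rational eigenvalues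
  have key : ∀ {c : Fin 2 → ℚ_[ℓ]} {v : W.rationalTateModule ℓ}, c = ⇑(b.repr v) → c ≠ 0 →
      w = μ • (f ∘ c) → False := by
    intro c v hcv hc0 hwc
    refine false_of_forall_apply_eq_smul W ℓ hCM (v := v)
      (fun hv0 => hc0 (by rw [hcv, hv0, map_zero, Finsupp.coe_zero]))
      fun σ => ?_
    obtain ⟨a, ha⟩ := hw' σ
    have ha' : (M σ).map f *ᵥ (f ∘ c) = a • (f ∘ c) := by
      rw [hwc, Matrix.mulVec_smul, smul_comm] at ha
      exact smul_right_injective _ hμ0 ha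
    obtain ⟨q, -, hq⟩ := exists_eq_map_of_mulVec_comp_eq_smul f hc0 ha'
    refine ⟨q, b.repr.injective (DFunLike.coe_injective ?_)⟩
    rw [← hrepr, ← hcv, hq, map_smul, Finsupp.coe_smul, hcv]
  rcases hμ with h | h
  · exact key hc₁def hc₁ h
  · exact key hcᵤdef hcᵤ h

/-- **Absolute irreducibility of `V_ℓ E` framed in any basis** (non-CM `E` over a number field,
given `τ₀` as above): `ρ.toGaloisRep.IsIrreducible` for
`ρ = framedTateGaloisRepOfBasis ℓ _ b : Γ_K →ₜ* GL₂(ℚ̄_ℓ)` — the hypothesis `hirr` of the route's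
target `ReducibleOrdinaryModular` (`isIrreducible_iff_not_hasCommonEigenvector`).
[cite: Serre1968, Ch. IV §2.1] -/
theorem isIrreducible_toGaloisRep_framedTate (hCM : ¬ W.HasCM)
    (b : Module.Basis (Fin 2) ℚ_[ℓ] (W.rationalTateModule ℓ)) {τ₀ : absoluteGaloisGroup K}
    {u : ℚ_[ℓ]} (hu : u ≠ 1)
    (hC : (W.rationalGaloisRepTate ℓ τ₀ - 1) * (W.rationalGaloisRepTate ℓ τ₀ - u • 1) = 0)
    {v₁ vᵤ : W.rationalTateModule ℓ} (hv₁ : v₁ ≠ 0) (hvᵤ : vᵤ ≠ 0)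
    (h₁ : W.rationalGaloisRepTate ℓ τ₀ v₁ = v₁) (hᵤ : W.rationalGaloisRepTate ℓ τ₀ vᵤ = u • vᵤ) :
    (W.framedTateGaloisRepOfBasis ℓ (W.continuous_rationalGaloisRepTate_holds ℓ) b).toGaloisRep.IsIrreducible :=
  (isIrreducible_iff_not_hasCommonEigenvector _).mpr
    (not_hasCommonEigenvector_framedTate W ℓ hCM b hu hC hv₁ hvᵤ h₁ hᵤ)

end Elliptic

end Summit.Langlands.Langlands.Theorems.FiveIsogenyEllipticCurves

end
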